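import Summits.QuantumFields.BalabanUV.Beta.EriceFlowEnclosureB12AsPrintedHistoryContagionShiftFlowPicard
import Mathlib.Analysis.Normed.Group.Tannery

/-!
# Beta / EriceFlowEnclosureB12AsPrintedHistoryContagionShiftFlowPicardLimit — ASYMPTOTIC FREEDOM IS CONTAGIOUS, part 13: THE LATTICE-FREE ITERATES CONVERGE —
# EXISTENCE AND WELL-POSEDNESS OF THE FLOW WITH MEMORY NEAR ZERO PIN, FLOOR-FREE.  Part 12 made node U2's solution map `picard B e` (`T4BetaFlowWellPosed`) preserve
# the class «box-valued, below 2e» with the quarter profile and contract consecutive iterates in the θ₁-weighted chart (`κ ≤ ½` under `64C_m e³ ≤ (1 − θ)²`).  Here: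
# the iterates `(picard B e)^[n] u` from ANY such start converge SCALE BY SCALE (ℝ complete), the limit is box-valued with the profile (positivity through node U2's
# `drive_le_mul_bbar`), and it is a FIXED POINT — `B` is continuous along dominated scale-wise convergence by its memory profile (Tannery's theorem), so
# `1∕h(m)² = 1∕e² + drive B h m`, i.e. `MemFlow B e h`.  For the constant start these are node U2's `iterate B e` and `solution B e` VERBATIM: node U2's
# `memFlow_solution ∕ existsUnique_memFlow ∕ eq_solution_of_memFlow ∕ tendsto_iterate` WITHOUT the floor `b ≤ B` and WITHOUT `C_m γ < b(1 − θ)`, from ONE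
# asymptotically free reference solution and smallness of the pin; uniqueness is part 10's `memFlow_unique_of_reference`.  Abstract in B; part 15 reads it on the
# as-printed carrier from [I] THEOREM 2 AS TYPED (β-flow team, prover 1, unit `b2b-balaban-beta-bflow-p1`, gen 37; ROW AP-I·Uc × NODE U2)

HONEST FRAMING (page 1 of everything the β sub-cell writes): discharging `BetaPertH` makes Bałaban's UV stability UNCONDITIONAL — a
real constructive-QFT result; it is NOT the continuum limit and NOT the Clay problem.  HONEST DEPENDENCY (cell reorg 2026-08-19,
verbatim): «continuum YM on T⁴ ⇐ BetaPertH ∧ nine spine estimates (0/9 proved); BetaPertH ⇐ (D1) ∧ (D4) ∧ CAP+tail; G-an2-4 gates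
asym, D1 and NE2/3/4.»  THIS MODULE DISCHARGES NOTHING: [folklore] real analysis (scale-wise Cauchy sequences in ℝ — Mathlib `cauchySeq_of_le_geometric`; Tannery's
theorem `tendsto_tsum_of_dominated_convergence`; uniqueness of limits) over node U2's HYPOTHESIS SHAPES `T4BetaStationary.{SeqBox, MemoryProfile}` and
`T4BetaFlowWellPosed.{MemFlow, drive, picard, iterate, solution, bbar}` on an ABSTRACT functional `B : (ℕ → ℝ) → ℝ` — the shapes node U2 derives (`memoryProfile_betaInf`,
`memFlow_gstar`) from its NE4 ∕ history-moduli LETTERS (NOT PRINTED for [I] = T. Bałaban, Commun. Math. Phys. **109** (1987) [Balaban1987RG1]: GAPS G-t4-U2-1 ∕ -2; p. 298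
says only that β_j depends on the preceding couplings); the reference profile is the shape of (0.31)'s lower half (Theorem 2 p. 259, STATED WITHOUT PROOF) in the
continuum, which parts 5 ∕ 6 derive for the limits of pinned families.  Nothing of Bałaban's β is asserted; node U2's `picard ∕ iterate ∕ solution ∕ drive_le_mul_bbar ∕
memFlow_of_invSq_eq ∕ one_div_sqrt_le` are USED BY NAME, nothing restated or modified.

WHAT THIS FILE PROVES (0 sorry, 0 def): `tendsto_B_shift_of_tendsto`, `tendsto_drive_of_tendsto`, `prof_le_invSq_of_le_invSprof`, **`exists_memFlow_of_reference`** (from ANY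
box-valued start ≤ 2e the Picard iterates converge scale-wise to a box solution with the quarter profile), `iterate_eq_picardIter`, **`memFlow_solution_of_reference`** (node
U2's `solution B e` is a box solution with the profile, the scale-wise limit of node U2's `iterate B e`), **`existsUnique_memFlow_of_reference`**,
**`eq_solution_of_memFlow_of_reference`**, **`tendsto_picardIter_solution`** (every enveloped start leads to THE solution), **`abs_picardIter_sub_solution_le`** (GEOMETRIC RATE
`2^{−n}`, scale-weighted by `(2∕(1+θ))^q`).  NOT CLAIMED: anything about Bałaban's β; existence away from zero pin or outside the box; `BetaPertH`; the continuum limit of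
the measures; Clay.
-/

namespace Summit.QuantumFields.BalabanUV.Beta.EriceFlowEnclosureB12AsPrintedHistoryContagionShiftFlowPicardLimit

open Finset Filter Topology
open Literature.MathematicalPhysics.QuantumFieldTheory.Balaban1983to89
open Literature.MathematicalPhysics.QuantumFieldTheory.Balaban1983to89.T4CouplingMatching (prof sprof sprof_pos sprof_sq prof_pos abs_sub_le_of_inv_sq)
open Literature.MathematicalPhysics.QuantumFieldTheory.Balaban1983to89.T4BetaStationary (SeqBox MemoryProfile summable_profile abs_sub_le_of_seqBox
  tsum_profile_le)
open Literature.MathematicalPhysics.QuantumFieldTheory.Balaban1983to89.T4BetaFlowWellPosed (MemFlow drive drive_succ drive_zero picard iterate solution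
  iterate_zero iterate_succ seqBox_shift invSq_eq_of_memFlow memFlow_of_invSq_eq one_div_sq_one_div_sqrt one_div_sqrt_one_div_sq abs_drive_sub_drive_le bbar
  drive_le_mul_bbar)
open Summit.QuantumFields.BalabanUV.Beta.EriceFlowEnclosureB12AsPrintedHistoryContagionShiftFlow (le_invSprof_of_prof_le memFlow_unique_of_reference)
open Summit.QuantumFields.BalabanUV.Beta.EriceFlowEnclosureB12AsPrintedHistoryContagionShiftFlowPicard (picardIter_mem picardIter_profile invSq_picardIter_succ
  kappa_le_half abs_invSq_picardIter_succ_sub_le dist_picardIter_succ_le)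

noncomputable section

/-! ## §16 Scale-wise convergence; the limit is a box solution: EXISTENCE floor-free -/

/-- CONTINUITY OF THE FUNCTIONAL ALONG DOMINATED SCALE-WISE CONVERGENCE: box histories `v_n → w` scale by scale ⟹ `B(v_n(p+·)) → B(w(p+·))` — the memory
profile bounds `|B v_n − B w|` by `C_m Σ' θ^j|v_n − w|(p+j)`, which tends to 0 by Tannery's theorem (dominating sequence `θ^j γ`). [folklore] -/
theorem tendsto_B_shift_of_tendsto {B : (ℕ → ℝ) → ℝ} {Cm θ γ : ℝ} {v : ℕ → ℕ → ℝ} {w : ℕ → ℝ}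
    (hB : MemoryProfile Cm θ γ B) (hθ0 : 0 ≤ θ) (hθ1 : θ < 1)
    (hvs : ∀ n, SeqBox γ (v n)) (hws : SeqBox γ w) (hlim : ∀ q, Tendsto (fun n => v n q) atTop (𝓝 (w q))) (p : ℕ) :
    Tendsto (fun n => B (fun j => v n (p + j))) atTop (𝓝 (B (fun j => w (p + j)))) := by
  have hT : Tendsto (fun n => ∑' j, θ ^ j * |v n (p + j) - w (p + j)|) atTop
      (𝓝 (∑' j : ℕ, θ ^ j * |w (p + j) - w (p + j)|)) := by
    refine tendsto_tsum_of_dominated_convergence (bound := fun j => θ ^ j * γ)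
      ((summable_geometric_of_lt_one hθ0 hθ1).mul_right γ) (fun j => ?_) (Eventually.of_forall fun n j => ?_)
    · exact (((hlim (p + j)).sub tendsto_const_nhds).abs).const_mul (θ ^ j)
    · rw [Real.norm_eq_abs, abs_of_nonneg (mul_nonneg (pow_nonneg hθ0 j) (abs_nonneg _))]
      exact mul_le_mul_of_nonneg_left (abs_sub_le_of_seqBox (seqBox_shift (hvs n) p) (seqBox_shift hws p) j) (pow_nonneg hθ0 j)
  simp only [sub_self, abs_zero, mul_zero, tsum_zero] at hT
  have h0 : Tendsto (fun n => B (fun j => v n (p + j)) - B (fun j => w (p + j))) atTop (𝓝 0) := by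
    refine squeeze_zero_norm (fun n => ?_) (by simpa using hT.const_mul Cm)
    rw [Real.norm_eq_abs]
    exact hB _ _ (seqBox_shift (hvs n) p) (seqBox_shift hws p)
  exact tendsto_sub_nhds_zero_iff.mp h0

/-- … hence the driving sums converge scale-wise: `drive B v_n m → drive B w m`. [folklore] -/
theorem tendsto_drive_of_tendsto {B : (ℕ → ℝ) → ℝ} {Cm θ γ : ℝ} {v : ℕ → ℕ → ℝ} {w : ℕ → ℝ}
    (hB : MemoryProfile Cm θ γ B) (hθ0 : 0 ≤ θ) (hθ1 : θ < 1)
    (hvs : ∀ n, SeqBox γ (v n)) (hws : SeqBox γ w) (hlim : ∀ q, Tendsto (fun n => v n q) atTop (𝓝 (w q))) (m : ℕ) :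
    Tendsto (fun n => drive B (v n) m) atTop (𝓝 (drive B w m)) := by
  unfold T4BetaFlowWellPosed.drive
  exact tendsto_finsetSum _ fun l _ => tendsto_B_shift_of_tendsto hB hθ0 hθ1 hvs hws hlim (l + 1)

/-- From the coupling to the profile: `0 < x ≤ 1∕√(1∕t_a² + β*q)` ⟹ `1∕t_a² + β*q ≤ 1∕x²`. [folklore] -/
theorem prof_le_invSq_of_le_invSprof {ta bs x : ℝ} (hta : 0 < ta) (hbs : 0 ≤ bs) {q : ℕ} (hx : 0 < x)
    (h : x ≤ 1 / sprof ta bs q) : 1 / ta ^ 2 + bs * (q : ℝ) ≤ 1 / x ^ 2 := by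
  have hsq : x ^ 2 ≤ (1 / sprof ta bs q) ^ 2 := pow_le_pow_left₀ hx.le h 2
  rw [one_div_pow, sprof_sq hta hbs] at hsq
  have : prof ta bs q ≤ 1 / x ^ 2 := by
    rw [le_one_div (prof_pos hta hbs q) (pow_pos hx 2)]
    exact hsq
  exact this

/-- **EXISTENCE NEAR ZERO PIN, FLOOR-FREE AND LATTICE-FREE.**  `B` with memory profile `MemoryProfile C_m θ γ B` (0 ≤ θ < 1, C_m ≥ 0); ONE box solution t of
`MemFlow B g* t` with the AF profile `1∕t_a² + β*·m ≤ 1∕t(m)²`; a pin `0 < e`, `2e ≤ γ`, below the threshold `4C_m e ≤ β*(1 − θ)`,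
`e²·(1∕g*² + C_mγ∕(1 − θ)² + (2C_m∕((1 − θ)β*))²) ≤ 3∕4`, `64·C_m e³ ≤ (1 − θ)²`; ANY box-valued start u ≤ 2e.  THEN the Picard iterates `(picard B e)^[n] u` converge
SCALE BY SCALE to a box solution h of the flow with memory from e, `MemFlow B e h`, carrying the quarter profile `1∕(4e²) + (β*∕4)m ≤ 1∕h(m)²`.  Node U2's
`T4BetaFlowWellPosed.memFlow_solution` with the floor `b ≤ B` and `C_m γ < b(1 − θ)` DELETED (scale-wise Cauchy from `abs_invSq_picardIter_succ_sub_le` at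
θ₁ = (1+θ)∕2, κ ≤ ½; positivity of the limit through `drive_le_mul_bbar`; the fixed point through `tendsto_drive_of_tendsto`). [cite: Balaban1987RG1, Thm 2 (0.31) p.259 with (0.20) p.256 and p.298] -/
theorem exists_memFlow_of_reference {B : (ℕ → ℝ) → ℝ} {Cm θ γ bs ta gs e : ℝ} {t u : ℕ → ℝ}
    (hB : MemoryProfile Cm θ γ B) (hCm : 0 ≤ Cm) (hθ0 : 0 ≤ θ) (hθ1 : θ < 1) (hbs : 0 < bs) (hta : 0 < ta)
    (hts : SeqBox γ t) (htf : MemFlow B gs t) (hprof : ∀ m : ℕ, 1 / ta ^ 2 + bs * (m : ℝ) ≤ 1 / (t m) ^ 2)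
    (he : 0 < e) (h2e : 2 * e ≤ γ) (hus : SeqBox γ u) (henv : ∀ q, u q ≤ 2 * e)
    (hs1 : 4 * Cm * e ≤ bs * (1 - θ))
    (hs2 : e ^ 2 * (1 / gs ^ 2 + Cm * γ / (1 - θ) ^ 2 + (2 * Cm / ((1 - θ) * bs)) ^ 2) ≤ 3 / 4)
    (hs4 : 64 * Cm * e ^ 3 ≤ (1 - θ) ^ 2) :
    ∃ h : ℕ → ℝ, SeqBox γ h ∧ MemFlow B e h ∧ (∀ m : ℕ, 1 / (4 * e ^ 2) + bs / 4 * (m : ℝ) ≤ 1 / (h m) ^ 2) ∧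
      ∀ q, Tendsto (fun n => (picard B e)^[n] u q) atTop (𝓝 (h q)) := by
  obtain ⟨hθθ₁, hθ₁1, hκ0, hκ1⟩ := kappa_le_half hCm hθ0 hθ1 he.le hs4
  set θ₁ : ℝ := (1 + θ) / 2 with hθ₁def
  set κ : ℝ := 8 * Cm * e ^ 3 / ((1 - θ / θ₁) * (1 - θ₁)) with hκdef
  set A₀ : ℝ := Cm * (γ / (1 - θ)) / (1 - θ₁) with hA₀def
  have hθ₁0 : 0 < θ₁ := lt_of_le_of_lt hθ0 hθθ₁
  have hκ1' : κ < 1 := by linarith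
  have hγ0 : 0 < γ := by linarith
  have hmem := picardIter_mem hB hCm hθ0 hθ1 hbs hta hts htf hprof he h2e hus henv hs1 hs2
  have hprofit := picardIter_profile hB hCm hθ0 hθ1 hbs hta hts htf hprof he h2e hus henv hs1 hs2
  have hinv := invSq_picardIter_succ hB hCm hθ0 hθ1 hbs hta hts htf hprof he h2e hus henv hs1 hs2
  -- scale-wise Cauchy in the coupling chart (part 12)
  have hstep : ∀ q n, dist ((picard B e)^[n + 1] u q) ((picard B e)^[n + 1 + 1] u q) ≤ (8 * e ^ 3 * A₀ / θ₁ ^ q) * κ ^ n :=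
    fun q n => dist_picardIter_succ_le hB hCm hθ0 hθ1 hbs hta hts htf hprof he h2e hus henv hs1 hs2 hθθ₁ hθ₁1 q n
  have hcauchy : ∀ q, CauchySeq fun n => (picard B e)^[n + 1] u q := fun q =>
    cauchySeq_of_le_geometric κ (8 * e ^ 3 * A₀ / θ₁ ^ q) hκ1' (hstep q)
  -- the scale-wise limit
  refine ⟨fun q => limUnder atTop fun n => (picard B e)^[n] u q, ?_⟩
  have hlim : ∀ q, Tendsto (fun n => (picard B e)^[n] u q) atTop (𝓝 (limUnder atTop fun n => (picard B e)^[n] u q)) := by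
    intro q
    obtain ⟨L, hL⟩ := cauchySeq_tendsto_of_complete (hcauchy q)
    exact tendsto_nhds_limUnder ⟨L, (tendsto_add_atTop_iff_nat 1).mp hL⟩
  set h : ℕ → ℝ := fun q => limUnder atTop fun n => (picard B e)^[n] u q with hhdef
  have hlim1 : ∀ q, Tendsto (fun n => (picard B e)^[n + 1] u q) atTop (𝓝 (h q)) := fun q =>
    (tendsto_add_atTop_iff_nat 1).mpr (hlim q)
  -- the limit is box-valued and carries the profile
  have hlow : ∀ (q n : ℕ), 1 / Real.sqrt (1 / e ^ 2 + (q : ℝ) * bbar B Cm θ γ) ≤ (picard B e)^[n + 1] u q := by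
    intro q n
    have hM : 1 / ((picard B e)^[n + 1] u q) ^ 2 ≤ 1 / e ^ 2 + (q : ℝ) * bbar B Cm θ γ := by
      rw [hinv n q]; linarith [drive_le_mul_bbar hB hCm hθ0 hθ1 hγ0 (hmem n).1 q]
    exact T4BetaFlowWellPosed.one_div_sqrt_le ((hmem (n + 1)).1 q).1 hM
  have hposh : ∀ q, 0 < h q := by
    intro q
    have hM0 : 0 < 1 / e ^ 2 + (q : ℝ) * bbar B Cm θ γ := by
      have hp1 := ((hmem (0 + 1)).1 q).1
      have hM : 1 / ((picard B e)^[0 + 1] u q) ^ 2 ≤ 1 / e ^ 2 + (q : ℝ) * bbar B Cm θ γ := by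
        rw [hinv 0 q]; linarith [drive_le_mul_bbar hB hCm hθ0 hθ1 hγ0 (hmem 0).1 q]
      exact (one_div_pos.mpr (pow_pos hp1 2)).trans_le hM
    exact (one_div_pos.mpr (Real.sqrt_pos.mpr hM0)).trans_le (ge_of_tendsto' (hlim1 q) fun n => hlow q n)
  have hhs : SeqBox γ h := fun q => ⟨hposh q, le_of_tendsto' (hlim q) fun n => ((hmem n).1 q).2⟩
  have h2e0 : 0 < 2 * e := by positivity
  have hb4 : 0 ≤ bs / 4 := by positivity
  have e4 : (2 * e) ^ 2 = 4 * e ^ 2 := by ring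
  have hprofh : ∀ m : ℕ, 1 / (4 * e ^ 2) + bs / 4 * (m : ℝ) ≤ 1 / (h m) ^ 2 := by
    intro m
    have hle : ∀ n, (picard B e)^[n + 1] u m ≤ 1 / sprof (2 * e) (bs / 4) m := fun n =>
      le_invSprof_of_prof_le h2e0 hb4 ((hmem (n + 1)).1 m).1 (by rw [e4]; exact hprofit n m)
    have := prof_le_invSq_of_le_invSprof h2e0 hb4 (hposh m) (le_of_tendsto' (hlim1 m) hle)
    rwa [e4] at this
  -- the limit is a fixed point: the driving sums converge (Tannery) and so does the chart variable
  have hflow : ∀ m, 1 / (h m) ^ 2 = 1 / e ^ 2 + drive B h m := by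
    intro m
    have h1 : Tendsto (fun n => 1 / ((picard B e)^[n + 1] u m) ^ 2) atTop (𝓝 (1 / e ^ 2 + drive B h m)) :=
      ((tendsto_drive_of_tendsto hB hθ0 hθ1 (fun n => (hmem n).1) hhs hlim m).const_add (1 / e ^ 2)).congr'
        (Eventually.of_forall fun n => (hinv n m).symm)
    have h2 : Tendsto (fun n => 1 / ((picard B e)^[n + 1] u m) ^ 2) atTop (𝓝 (1 / (h m) ^ 2)) :=
      tendsto_const_nhds.div ((hlim1 m).pow 2) (pow_ne_zero 2 (hposh m).ne')
    exact tendsto_nhds_unique h2 h1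
  exact ⟨hhs, memFlow_of_invSq_eq he hposh hflow, hprofh, hlim⟩

/-- Node U2's iterates ARE the Picard iterates from the constant history: `iterate B e n = (picard B e)^[n] (e, e, …)`. [folklore] -/
theorem iterate_eq_picardIter (B : (ℕ → ℝ) → ℝ) (e : ℝ) : ∀ n : ℕ, iterate B e n = (picard B e)^[n] (fun _ => e) := by
  intro n
  induction n with
  | zero => rfl
  | succ n ih => rw [iterate_succ, ih, Function.iterate_succ_apply']

/-- **NODE U2's `solution B e` IS A BOX SOLUTION NEAR ZERO PIN, FLOOR-FREE** — the scale-wise limit of node U2's `iterate B e` (the constant start e is box-valued and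
below 2e): `SeqBox γ (solution B e)`, `MemFlow B e (solution B e)`, the quarter profile, and `iterate B e n m → solution B e m`.  `T4BetaFlowWellPosed.memFlow_solution ∕
solution_seqBox ∕ tendsto_iterate` with `(hb, hlo, hsmall)` replaced by ONE AF reference solution and smallness of the pin. [cite: Balaban1987RG1, Thm 2 (0.31) p.259 with (0.20) p.256 and p.298] -/
theorem memFlow_solution_of_reference {B : (ℕ → ℝ) → ℝ} {Cm θ γ bs ta gs e : ℝ} {t : ℕ → ℝ}
    (hB : MemoryProfile Cm θ γ B) (hCm : 0 ≤ Cm) (hθ0 : 0 ≤ θ) (hθ1 : θ < 1) (hbs : 0 < bs) (hta : 0 < ta)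
    (hts : SeqBox γ t) (htf : MemFlow B gs t) (hprof : ∀ m : ℕ, 1 / ta ^ 2 + bs * (m : ℝ) ≤ 1 / (t m) ^ 2)
    (he : 0 < e) (h2e : 2 * e ≤ γ)
    (hs1 : 4 * Cm * e ≤ bs * (1 - θ))
    (hs2 : e ^ 2 * (1 / gs ^ 2 + Cm * γ / (1 - θ) ^ 2 + (2 * Cm / ((1 - θ) * bs)) ^ 2) ≤ 3 / 4)
    (hs4 : 64 * Cm * e ^ 3 ≤ (1 - θ) ^ 2) :
    SeqBox γ (solution B e) ∧ MemFlow B e (solution B e) ∧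
      (∀ m : ℕ, 1 / (4 * e ^ 2) + bs / 4 * (m : ℝ) ≤ 1 / (solution B e m) ^ 2) ∧
      ∀ m, Tendsto (fun n => iterate B e n m) atTop (𝓝 (solution B e m)) := by
  have hus : SeqBox γ (fun _ : ℕ => e) := fun _ => ⟨he, by linarith⟩
  have henv : ∀ q : ℕ, (fun _ : ℕ => e) q ≤ 2 * e := fun _ => by simp only; linarith
  obtain ⟨h, hhs, hhf, hprofh, hlim⟩ :=
    exists_memFlow_of_reference hB hCm hθ0 hθ1 hbs hta hts htf hprof he h2e hus henv hs1 hs2 hs4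
  have hlim' : ∀ m, Tendsto (fun n => iterate B e n m) atTop (𝓝 (h m)) := fun m =>
    (hlim m).congr fun n => by rw [iterate_eq_picardIter]
  have hsol : solution B e = h := funext fun m => (hlim' m).limUnder_eq
  rw [hsol]
  exact ⟨hhs, hhf, hprofh, hlim'⟩

/-- **WELL-POSEDNESS NEAR ZERO PIN, FLOOR-FREE**: exactly one box solution of the flow with memory from every pin e below the threshold — node U2's
`T4BetaFlowWellPosed.existsUnique_memFlow` with `(hb, hlo, hsmall)` replaced by ONE asymptotically free reference solution and smallness of e (existence:
`memFlow_solution_of_reference`; uniqueness: part 10's `memFlow_unique_of_reference`). [cite: Balaban1987RG1, Thm 2 (0.31) p.259 with (0.20) p.256 and p.298] -/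
theorem existsUnique_memFlow_of_reference {B : (ℕ → ℝ) → ℝ} {Cm θ γ bs ta gs e : ℝ} {t : ℕ → ℝ}
    (hB : MemoryProfile Cm θ γ B) (hCm : 0 ≤ Cm) (hθ0 : 0 ≤ θ) (hθ1 : θ < 1) (hbs : 0 < bs) (hta : 0 < ta)
    (hts : SeqBox γ t) (htf : MemFlow B gs t) (hprof : ∀ m : ℕ, 1 / ta ^ 2 + bs * (m : ℝ) ≤ 1 / (t m) ^ 2)
    (he : 0 < e) (h2e : 2 * e ≤ γ)
    (hs1 : 4 * Cm * e ≤ bs * (1 - θ))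
    (hs2 : e ^ 2 * (1 / gs ^ 2 + Cm * γ / (1 - θ) ^ 2 + (2 * Cm / ((1 - θ) * bs)) ^ 2) ≤ 3 / 4)
    (hs4 : 64 * Cm * e ^ 3 ≤ (1 - θ) ^ 2) : ∃! h : ℕ → ℝ, SeqBox γ h ∧ MemFlow B e h := by
  obtain ⟨hss, hsf, -, -⟩ := memFlow_solution_of_reference hB hCm hθ0 hθ1 hbs hta hts htf hprof he h2e hs1 hs2 hs4
  exact ⟨solution B e, ⟨hss, hsf⟩, fun h hh =>
    memFlow_unique_of_reference hB hCm hθ0 hθ1 hbs hta hts htf hprof hh.1 hh.2 hss hsf hs1 hs2 hs4⟩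

/-- ANY box solution from e IS node U2's `solution B e` (so it is the scale-wise limit of the lattice-free iterates) — `T4BetaFlowWellPosed.eq_solution_of_memFlow`
floor-free. [cite: Balaban1987RG1, Thm 2 (0.31) p.259 with (0.20) p.256] -/
theorem eq_solution_of_memFlow_of_reference {B : (ℕ → ℝ) → ℝ} {Cm θ γ bs ta gs e : ℝ} {t h : ℕ → ℝ}
    (hB : MemoryProfile Cm θ γ B) (hCm : 0 ≤ Cm) (hθ0 : 0 ≤ θ) (hθ1 : θ < 1) (hbs : 0 < bs) (hta : 0 < ta)
    (hts : SeqBox γ t) (htf : MemFlow B gs t) (hprof : ∀ m : ℕ, 1 / ta ^ 2 + bs * (m : ℝ) ≤ 1 / (t m) ^ 2)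
    (he : 0 < e) (h2e : 2 * e ≤ γ)
    (hs1 : 4 * Cm * e ≤ bs * (1 - θ))
    (hs2 : e ^ 2 * (1 / gs ^ 2 + Cm * γ / (1 - θ) ^ 2 + (2 * Cm / ((1 - θ) * bs)) ^ 2) ≤ 3 / 4)
    (hs4 : 64 * Cm * e ^ 3 ≤ (1 - θ) ^ 2) (hhs : SeqBox γ h) (hhf : MemFlow B e h) : h = solution B e := by
  obtain ⟨hss, hsf, -, -⟩ := memFlow_solution_of_reference hB hCm hθ0 hθ1 hbs hta hts htf hprof he h2e hs1 hs2 hs4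
  exact memFlow_unique_of_reference hB hCm hθ0 hθ1 hbs hta hts htf hprof hhs hhf hss hsf hs1 hs2 hs4

/-- EVERY ENVELOPED START LEADS TO THE SAME SOLUTION: for any box-valued u ≤ 2e, `(picard B e)^[n] u q → solution B e q` at every scale q. [folklore] -/
theorem tendsto_picardIter_solution {B : (ℕ → ℝ) → ℝ} {Cm θ γ bs ta gs e : ℝ} {t u : ℕ → ℝ}
    (hB : MemoryProfile Cm θ γ B) (hCm : 0 ≤ Cm) (hθ0 : 0 ≤ θ) (hθ1 : θ < 1) (hbs : 0 < bs) (hta : 0 < ta)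
    (hts : SeqBox γ t) (htf : MemFlow B gs t) (hprof : ∀ m : ℕ, 1 / ta ^ 2 + bs * (m : ℝ) ≤ 1 / (t m) ^ 2)
    (he : 0 < e) (h2e : 2 * e ≤ γ) (hus : SeqBox γ u) (henv : ∀ q, u q ≤ 2 * e)
    (hs1 : 4 * Cm * e ≤ bs * (1 - θ))
    (hs2 : e ^ 2 * (1 / gs ^ 2 + Cm * γ / (1 - θ) ^ 2 + (2 * Cm / ((1 - θ) * bs)) ^ 2) ≤ 3 / 4)
    (hs4 : 64 * Cm * e ^ 3 ≤ (1 - θ) ^ 2) (q : ℕ) :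
    Tendsto (fun n => (picard B e)^[n] u q) atTop (𝓝 (solution B e q)) := by
  obtain ⟨h, hhs, hhf, -, hlim⟩ :=
    exists_memFlow_of_reference hB hCm hθ0 hθ1 hbs hta hts htf hprof he h2e hus henv hs1 hs2 hs4
  rw [← eq_solution_of_memFlow_of_reference hB hCm hθ0 hθ1 hbs hta hts htf hprof he h2e hs1 hs2 hs4 hhs hhf]
  exact hlim q

/-- **THE LATTICE-FREE ITERATES CONVERGE AT THE GEOMETRIC RATE 2^{−n}**: from any box-valued start u ≤ 2e,
`|((picard B e)^[n+1] u)(q) − solution B e q| ≤ (32·C_m γ e³∕(1 − θ)²)·(2∕(1+θ))^q·2^{−n}` (θ₁ = (1+θ)∕2, κ ≤ ½; Mathlib `dist_le_of_le_geometric_of_tendsto`) — node U2's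
`abs_iterate_sub_solution_le` floor-free, the price of the floor being the scale weight `(2∕(1+θ))^q`. [folklore] -/
theorem abs_picardIter_sub_solution_le {B : (ℕ → ℝ) → ℝ} {Cm θ γ bs ta gs e : ℝ} {t u : ℕ → ℝ}
    (hB : MemoryProfile Cm θ γ B) (hCm : 0 ≤ Cm) (hθ0 : 0 ≤ θ) (hθ1 : θ < 1) (hbs : 0 < bs) (hta : 0 < ta)
    (hts : SeqBox γ t) (htf : MemFlow B gs t) (hprof : ∀ m : ℕ, 1 / ta ^ 2 + bs * (m : ℝ) ≤ 1 / (t m) ^ 2)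
    (he : 0 < e) (h2e : 2 * e ≤ γ) (hus : SeqBox γ u) (henv : ∀ q, u q ≤ 2 * e)
    (hs1 : 4 * Cm * e ≤ bs * (1 - θ))
    (hs2 : e ^ 2 * (1 / gs ^ 2 + Cm * γ / (1 - θ) ^ 2 + (2 * Cm / ((1 - θ) * bs)) ^ 2) ≤ 3 / 4)
    (hs4 : 64 * Cm * e ^ 3 ≤ (1 - θ) ^ 2) (q n : ℕ) :
    |(picard B e)^[n + 1] u q - solution B e q| ≤ 32 * Cm * γ * e ^ 3 / (1 - θ) ^ 2 / ((1 + θ) / 2) ^ q * (1 / 2) ^ n := by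
  obtain ⟨hθθ₁, hθ₁1, hκ0, hκ1⟩ := kappa_le_half hCm hθ0 hθ1 he.le hs4
  set θ₁ : ℝ := (1 + θ) / 2 with hθ₁def
  set κ : ℝ := 8 * Cm * e ^ 3 / ((1 - θ / θ₁) * (1 - θ₁)) with hκdef
  have hθ₁0 : 0 < θ₁ := lt_of_le_of_lt hθ0 hθθ₁
  have h1θ : 0 < 1 - θ := by linarith
  have hγ : 0 ≤ γ := (hus 0).1.le.trans (hus 0).2
  have hκ1' : κ < 1 := by linarith
  have hstep : ∀ n, dist ((picard B e)^[n + 1] u q) ((picard B e)^[n + 1 + 1] u q)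
      ≤ (8 * e ^ 3 * (Cm * (γ / (1 - θ)) / (1 - θ₁)) / θ₁ ^ q) * κ ^ n :=
    fun n => dist_picardIter_succ_le hB hCm hθ0 hθ1 hbs hta hts htf hprof he h2e hus henv hs1 hs2 hθθ₁ hθ₁1 q n
  have hlim1 : Tendsto (fun n => (picard B e)^[n + 1] u q) atTop (𝓝 (solution B e q)) :=
    (tendsto_add_atTop_iff_nat 1).mpr (tendsto_picardIter_solution hB hCm hθ0 hθ1 hbs hta hts htf hprof he h2e hus henv hs1 hs2 hs4 q)
  have h := dist_le_of_le_geometric_of_tendsto κ _ hκ1' hstep hlim1 n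
  rw [Real.dist_eq] at h
  have hC : 8 * e ^ 3 * (Cm * (γ / (1 - θ)) / (1 - θ₁)) / θ₁ ^ q = 16 * Cm * γ * e ^ 3 / (1 - θ) ^ 2 / θ₁ ^ q := by
    have h1θ₁ : 1 - θ₁ = (1 - θ) / 2 := by rw [hθ₁def]; ring
    have h1θne : (1 - θ) ≠ 0 := h1θ.ne'
    have hθ₁q : θ₁ ^ q ≠ 0 := pow_ne_zero q hθ₁0.ne'
    rw [h1θ₁]
    field_simp
    ring
  have hC0 : 0 ≤ 16 * Cm * γ * e ^ 3 / (1 - θ) ^ 2 / θ₁ ^ q := by positivity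
  rw [hC] at h
  calc |(picard B e)^[n + 1] u q - solution B e q| ≤ 16 * Cm * γ * e ^ 3 / (1 - θ) ^ 2 / θ₁ ^ q * κ ^ n / (1 - κ) := h
    _ ≤ 16 * Cm * γ * e ^ 3 / (1 - θ) ^ 2 / θ₁ ^ q * (1 / 2) ^ n / (1 / 2) :=
        div_le_div₀ (by positivity) (mul_le_mul_of_nonneg_left (pow_le_pow_left₀ hκ0 hκ1 n) hC0) (by norm_num) (by linarith)
    _ = 32 * Cm * γ * e ^ 3 / (1 - θ) ^ 2 / θ₁ ^ q * (1 / 2) ^ n := by ring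

end

end Summit.QuantumFields.BalabanUV.Beta.EriceFlowEnclosureB12AsPrintedHistoryContagionShiftFlowPicardLimit
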